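import Mathlib
import HarnessLib
import Summits.NavierStokesRegularity.NavierStokesRegularity.Theorems.PoloidalWindowDoorLrcModEntireCaseIEntrance
import Summits.NavierStokesRegularity.NavierStokesRegularity.Theorems.PoloidalWindowDoorLrcModEntireSonicSheetStrainWindow

/-!
# Route `PoloidalWindowDoor`, item `LrcModEntire` (stmt-NavierStokesRegularity-20428), cell (Q4-sonic, straight, μ < 0) `stub_Q4sonicLineNeg`, case I —
# THE v14 CHILD «EVERY NEARBY TIME SONIC» REDUCED TO THE TWO BRANCH ENDS (registry currency ⇒ box currency)

Cell ns-regularity-ideate, stub-worker seat ns-poloidal-K2-p2 g17 under the LEAD of item 20428 (ns-poloidal-K2-p3 g17; T2B-g17 §7/§9, `CASE-I-SPLIT-v14.md` Child 1,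
PICK 20:42:04Z (P4) «the WRAPPER `stub_Q4sonicLineNeg_sonicTimes_closed` with EXACTLY the statement of Child 1 — whoever lands last»); `--supports
stmt-NavierStokesRegularity-20428 --as helper`.

* ★★ `caseI_false_of_ends` — **the statement of the v14 child `stub_Q4sonicLineNegSonicTimes` VERBATIM** (the registered `stub_Q4sonicLineNeg` of twist_split v13 +
  the literal «∃ δ′ > 0, ∀ τ, |τ| < δ′ → R(τ,·) affine on |z| < δ»), derived from TWO HYPOTHESES written out in the box currency of the assembly A-I:
  the s-FREE END («strain row ≡ 0 on the web sheet over an open interval of times ⇒ False» — port-2 g8's `…CaseISfreeBranch.caseI_sfree_false` with `O` the tube box,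
  data from `…SheetCauchyDataPeriodic.cauchyData_sfree_of_strain`, `μ` smooth by `…SlopeSmooth`) and the PERIODIC END («one `s`-period `L > 0` of `U(−1+τ)` along every
  web over an open interval of times ⇒ False» — the difference-system template, T2B-g17 §9, in the pipeline).  Inside: unpack the binders (K2-p2 g16's pattern of
  `…Q4CurvedPeriodicStub`), `subst F`, `…CaseIEntrance.caseI_entrance` (web package + sonic + parallel + `μ < 0` on ONE box), `…SonicSheetStrainWindow.sheet_strain_window`
  (the J-dichotomy), dispatch.  When both ends are tree theorems the registered child is closed BY NAME by a one-line instantiation.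

WHAT THIS IS NOT: not a claim about Navier–Stokes regularity; a CONDITIONAL reduction of the v14 child to two named ends — no registry stub is closed here;
items 20428 / 19708 / 27893 OPEN (bears_on LADDER-NS N0).
-/

noncomputable section

set_option linter.dupNamespace false
set_option linter.style.longLine false

namespace Summit.NavierStokesRegularity.NavierStokesRegularity.Theorems.PoloidalWindowDoorLrcModEntireCaseISonicTimes

open Set Function Filter Topology Metric
open scoped RealInnerProductSpace InnerProductSpace Laplacian ContDiff
open Summit.NavierStokesRegularity.NavierStokesRegularity.Theorems.PoloidalWindowDoorLrcModEntireSheetFlattenTools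
open Summit.NavierStokesRegularity.NavierStokesRegularity.Theorems.PoloidalWindowDoorLrcModEntireCaseIEntrance
open Summit.NavierStokesRegularity.NavierStokesRegularity.Theorems.PoloidalWindowDoorLrcModEntireSonicSheetStrainWindow

/-- ★★ **CASE I OF `stub_Q4sonicLineNeg` FROM THE TWO BRANCH ENDS.**  First hypothesis: the s-FREE END; second: the PERIODIC END (both in the box currency of
`…CaseIEntrance.caseI_entrance` / `…SonicSheetStrainWindow.sheet_strain_window`); conclusion: the v14 child `stub_Q4sonicLineNegSonicTimes` VERBATIM. -/
theorem caseI_false_of_ends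
    (hSfreeEnd : (∀ (C σ ρ δ' r : ℝ) (U : ℝ → EuclideanSpace ℝ (Fin 3) → EuclideanSpace ℝ (Fin 3)) (R μ : ℝ → ℝ → ℝ) (e : EuclideanSpace ℝ (Fin 3))
      (n₀ : ℝ × ℝ × ℝ → ℝ) (κt : ℝ → ℝ → ℝ) (τ₁ τ₂ : ℝ),
      Literature.Analysis.FluidPDE.HasTypeITimeDecay C U →
      ContinuousOn (Function.uncurry U) (Set.Iio (0 : ℝ) ×ˢ Set.univ) →
      (∀ s t : ℝ, s < t → t < 0 → ∀ x, U t x =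
        Literature.Analysis.UnboundedOperators.heatExtension (U s) (t - s) x - Literature.Analysis.FluidPDE.oseenDuhamel 1 s U U t x) →
      (∀ t < 0, Literature.Analysis.FluidPDE.VectorCalculus.IsDivFree (U t)) →
      (∀ s < 0, ∀ y, ⟪Literature.Analysis.FluidPDE.curl (U s) y, EuclideanSpace.single 2 1⟫_ℝ = 0) →
      U (-1) 0 2 ≠ 0 → (σ = 1 ∨ σ = -1) → ContDiff ℝ 3 (Function.uncurry μ) →
      (∀ t : ℝ, |t + 1| < ρ → ∀ x : EuclideanSpace ℝ (Fin 3), |x 2| < ρ → ∀ b : Fin 3, b ≠ 2 →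
        fderiv ℝ (U t) x (EuclideanSpace.single 2 1) b = μ t (x 2) * fderiv ℝ (U t) x (EuclideanSpace.single b 1) 2) →
      δ' ≤ ρ → δ' < 1 / 2 → e 2 = 0 → e 0 ^ 2 + e 1 ^ 2 = 1 →
      (∀ q : ℝ × ℝ × ℝ, |q.1| < δ' → |q.2.2| < δ' →
        n₀ q ∈ Set.Ioo (-r) r ∧
        σ * U (-1 + q.1) (frameCLM e (q.2.1, n₀ q, q.2.2)) 2 = R q.1 q.2.2 ∧
        (∀ n ∈ Set.Icc (-r) r, n ≠ n₀ q → σ * U (-1 + q.1) (frameCLM e (q.2.1, n, q.2.2)) 2 < R q.1 q.2.2) ∧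
        (∀ w : EuclideanSpace ℝ (Fin 3), w 2 = 0 → fderiv ℝ (fun y => U (-1 + q.1) y 2) (frameCLM e (q.2.1, n₀ q, q.2.2)) w = 0) ∧
        (∀ m : ℕ∞, ContDiffAt ℝ m n₀ q) ∧
        0 < κt q.1 q.2.2 ∧
        fderiv ℝ (fderiv ℝ (fun y => σ * U (-1 + q.1) y 2)) (frameCLM e (q.2.1, n₀ q, q.2.2)) e e +
            fderiv ℝ (fderiv ℝ (fun y => σ * U (-1 + q.1) y 2)) (frameCLM e (q.2.1, n₀ q, q.2.2)) (Jvec e) (Jvec e) =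
          -κt q.1 q.2.2 ∧
        κt q.1 q.2.2 * (fderiv ℝ n₀ q ((0 : ℝ), (0 : ℝ), (1 : ℝ))) ^ 2 =
          (deriv (deriv (R q.1)) q.2.2 - μ (-1 + q.1) q.2.2 * κt q.1 q.2.2) * (1 + (fderiv ℝ n₀ q ((0 : ℝ), (1 : ℝ), (0 : ℝ))) ^ 2)) →
      (∀ τ : ℝ, |τ| < δ' → ∃ A B : ℝ, ∀ z : ℝ, |z| < δ' → R τ z = A + B * z) →
      (∀ τ s z : ℝ, |τ| < δ' → |z| < δ' → n₀ (τ, s, z) = n₀ (τ, (0 : ℝ), z)) →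
      (∀ τ z : ℝ, |τ| < δ' → |z| < δ' → μ (-1 + τ) z < 0) →
      -δ' ≤ τ₁ → τ₁ < τ₂ → τ₂ ≤ δ' →
      (∀ τ ∈ Set.Ioo τ₁ τ₂, ∀ s z : ℝ, |z| < δ' →
        ⟪fderiv ℝ (U (-1 + τ)) (frameCLM e (s, n₀ (τ, s, z), z)) e, e⟫_ℝ = 0 ∧
        ⟪fderiv ℝ (U (-1 + τ)) (frameCLM e (s, n₀ (τ, s, z), z)) e, Jvec e⟫_ℝ = 0) → False))
    (hPeriodicEnd : (∀ (C σ ρ δ' r : ℝ) (U : ℝ → EuclideanSpace ℝ (Fin 3) → EuclideanSpace ℝ (Fin 3)) (R μ : ℝ → ℝ → ℝ) (e : EuclideanSpace ℝ (Fin 3))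
      (n₀ : ℝ × ℝ × ℝ → ℝ) (κt : ℝ → ℝ → ℝ) (τ₁ τ₂ L : ℝ),
      Literature.Analysis.FluidPDE.HasTypeITimeDecay C U →
      ContinuousOn (Function.uncurry U) (Set.Iio (0 : ℝ) ×ˢ Set.univ) →
      (∀ s t : ℝ, s < t → t < 0 → ∀ x, U t x =
        Literature.Analysis.UnboundedOperators.heatExtension (U s) (t - s) x - Literature.Analysis.FluidPDE.oseenDuhamel 1 s U U t x) →
      (∀ t < 0, Literature.Analysis.FluidPDE.VectorCalculus.IsDivFree (U t)) →
      (∀ s < 0, ∀ y, ⟪Literature.Analysis.FluidPDE.curl (U s) y, EuclideanSpace.single 2 1⟫_ℝ = 0) →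
      U (-1) 0 2 ≠ 0 → (σ = 1 ∨ σ = -1) → ContDiff ℝ 3 (Function.uncurry μ) →
      (∀ t : ℝ, |t + 1| < ρ → ∀ x : EuclideanSpace ℝ (Fin 3), |x 2| < ρ → ∀ b : Fin 3, b ≠ 2 →
        fderiv ℝ (U t) x (EuclideanSpace.single 2 1) b = μ t (x 2) * fderiv ℝ (U t) x (EuclideanSpace.single b 1) 2) →
      δ' ≤ ρ → δ' < 1 / 2 → e 2 = 0 → e 0 ^ 2 + e 1 ^ 2 = 1 →
      (∀ q : ℝ × ℝ × ℝ, |q.1| < δ' → |q.2.2| < δ' →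
        n₀ q ∈ Set.Ioo (-r) r ∧
        σ * U (-1 + q.1) (frameCLM e (q.2.1, n₀ q, q.2.2)) 2 = R q.1 q.2.2 ∧
        (∀ n ∈ Set.Icc (-r) r, n ≠ n₀ q → σ * U (-1 + q.1) (frameCLM e (q.2.1, n, q.2.2)) 2 < R q.1 q.2.2) ∧
        (∀ w : EuclideanSpace ℝ (Fin 3), w 2 = 0 → fderiv ℝ (fun y => U (-1 + q.1) y 2) (frameCLM e (q.2.1, n₀ q, q.2.2)) w = 0) ∧
        (∀ m : ℕ∞, ContDiffAt ℝ m n₀ q) ∧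
        0 < κt q.1 q.2.2 ∧
        fderiv ℝ (fderiv ℝ (fun y => σ * U (-1 + q.1) y 2)) (frameCLM e (q.2.1, n₀ q, q.2.2)) e e +
            fderiv ℝ (fderiv ℝ (fun y => σ * U (-1 + q.1) y 2)) (frameCLM e (q.2.1, n₀ q, q.2.2)) (Jvec e) (Jvec e) =
          -κt q.1 q.2.2 ∧
        κt q.1 q.2.2 * (fderiv ℝ n₀ q ((0 : ℝ), (0 : ℝ), (1 : ℝ))) ^ 2 =
          (deriv (deriv (R q.1)) q.2.2 - μ (-1 + q.1) q.2.2 * κt q.1 q.2.2) * (1 + (fderiv ℝ n₀ q ((0 : ℝ), (1 : ℝ), (0 : ℝ))) ^ 2)) →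
      (∀ τ : ℝ, |τ| < δ' → ∃ A B : ℝ, ∀ z : ℝ, |z| < δ' → R τ z = A + B * z) →
      (∀ τ s z : ℝ, |τ| < δ' → |z| < δ' → n₀ (τ, s, z) = n₀ (τ, (0 : ℝ), z)) →
      (∀ τ z : ℝ, |τ| < δ' → |z| < δ' → μ (-1 + τ) z < 0) →
      -δ' ≤ τ₁ → τ₁ < τ₂ → τ₂ ≤ δ' → 0 < L →
      (∀ τ ∈ Set.Ioo τ₁ τ₂, ∀ s z : ℝ, |z| < δ' →
        U (-1 + τ) (frameCLM e (s + L, n₀ (τ, s + L, z), z)) = U (-1 + τ) (frameCLM e (s, n₀ (τ, s, z), z))) → False)) :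
    ∀ (C : ℝ) (v : ℝ → EuclideanSpace ℝ (Fin 3) → EuclideanSpace ℝ (Fin 3)) (W : Set (ℝ × EuclideanSpace ℝ (Fin 3))),
      (Literature.Analysis.FluidPDE.HasTypeITimeDecay C v ∧
        ContinuousOn (Function.uncurry v) (Set.Iio (0 : ℝ) ×ˢ Set.univ) ∧
        (∀ s t : ℝ, s < t → t < 0 → ∀ x, v t x =
          Literature.Analysis.UnboundedOperators.heatExtension (v s) (t - s) x -
            Literature.Analysis.FluidPDE.oseenDuhamel 1 s v v t x) ∧
        (∀ t < 0, Literature.Analysis.FluidPDE.VectorCalculus.IsDivFree (v t)) ∧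
        (∀ s < 0, ∀ y, ⟪Literature.Analysis.FluidPDE.curl (v s) y, EuclideanSpace.single 2 1⟫_ℝ = 0) ∧
        v (-1) 0 2 ≠ 0 ∧ (∀ t < 0, ∀ x, Real.sqrt (-t) * |v t x 2| ≤ |v (-1) 0 2|) ∧
        (∀ h : EuclideanSpace ℝ (Fin 3), fderiv ℝ (v (-1)) 0 h 2 = 0) ∧
        (deriv (fun s => v s 0 2) (-1) = v (-1) 0 2 / 2 ∧ v (-1) 0 2 * (Δ (fun y => v (-1) y 2)) 0 ≤ 0)) →
      (IsOpen W ∧ W.Nonempty ∧ W ⊆ Set.Iio (0 : ℝ) ×ˢ Set.univ ∧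
        (∀ z ∈ W, (Literature.Analysis.FluidPDE.curl (v z.1) z.2 ≠ 0 ∧
            (fderiv ℝ (v z.1) z.2 (EuclideanSpace.single 0 1) 2 ≠ 0 ∨ fderiv ℝ (v z.1) z.2 (EuclideanSpace.single 1 1) 2 ≠ 0) ∧
            (fderiv ℝ (v z.1) z.2 (EuclideanSpace.single 2 1) 0 ≠ 0 ∨ fderiv ℝ (v z.1) z.2 (EuclideanSpace.single 2 1) 1 ≠ 0))) ∧
        (∀ m : ℝ → ℝ, ∀ W₁ : Set (ℝ × EuclideanSpace ℝ (Fin 3)), W₁ ⊆ W → IsOpen W₁ → W₁.Nonempty →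
            ∃ z ∈ W₁, ∃ b : Fin 3, b ≠ 2 ∧
              fderiv ℝ (v z.1) z.2 (EuclideanSpace.single 2 1) b ≠
                m z.1 * fderiv ℝ (v z.1) z.2 (EuclideanSpace.single b 1) 2) ∧
        (∀ z ∈ W, (fderiv ℝ (fun x => fderiv ℝ (v z.1) x (EuclideanSpace.single 2 1) 2) z.2 (EuclideanSpace.single 0 1) *
                fderiv ℝ (v z.1) z.2 (EuclideanSpace.single 1 1) 2 -
              fderiv ℝ (fun x => fderiv ℝ (v z.1) x (EuclideanSpace.single 2 1) 2) z.2 (EuclideanSpace.single 1 1) *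
                fderiv ℝ (v z.1) z.2 (EuclideanSpace.single 0 1) 2 ≠ 0)) ∧
        (∃ m : ℝ → ℝ → ℝ, ∀ z ∈ W, ∀ b : Fin 3, b ≠ 2 →
            fderiv ℝ (v z.1) z.2 (EuclideanSpace.single 2 1) b =
              m z.1 (z.2 2) * fderiv ℝ (v z.1) z.2 (EuclideanSpace.single b 1) 2)) →
      (∀ t < 0, ∀ x x' : EuclideanSpace ℝ (Fin 3), x 2 = x' 2 → ∀ b c : Fin 3, b ≠ 2 → c ≠ 2 →
        fderiv ℝ (v t) x (EuclideanSpace.single 2 1) b * fderiv ℝ (v t) x' (EuclideanSpace.single c 1) 2 =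
          fderiv ℝ (v t) x' (EuclideanSpace.single 2 1) c * fderiv ℝ (v t) x (EuclideanSpace.single b 1) 2) →
      (∀ (s z₀ σ M : ℝ) (K O : Set (EuclideanSpace ℝ (Fin 3))), s < 0 →
        ((σ = 1 ∨ σ = -1) ∧ IsCompact K ∧ K.Nonempty ∧ (∀ y ∈ K, y 2 = z₀ ∧ σ * v s y 2 = M) ∧
          IsOpen O ∧ K ⊆ O ∧ (∀ y ∈ O, y 2 = z₀ → σ * v s y 2 ≤ M) ∧
          (∀ y ∈ O, y 2 = z₀ → σ * v s y 2 = M → y ∈ K)) → False) →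
      (∀ s < 0, ∀ y, ⟪fderiv ℝ (v s) y (Literature.Analysis.FluidPDE.curl (v s) y), EuclideanSpace.single 2 1⟫_ℝ = 0) →
      IsClosed ({y : EuclideanSpace ℝ (Fin 3) | y 2 = 0 ∧ v (-1) y 2 = v (-1) 0 2}) →
      (∀ y ∈ {y : EuclideanSpace ℝ (Fin 3) | y 2 = 0 ∧ v (-1) y 2 = v (-1) 0 2}, fderiv ℝ (fun x => v (-1) x 2) y = 0) →
      (∀ K O : Set (EuclideanSpace ℝ (Fin 3)), IsCompact K → K.Nonempty → K ⊆ {y : EuclideanSpace ℝ (Fin 3) | y 2 = 0 ∧ v (-1) y 2 = v (-1) 0 2} →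
        IsOpen O → K ⊆ O → O ∩ {y : EuclideanSpace ℝ (Fin 3) | y 2 = 0 ∧ v (-1) y 2 = v (-1) 0 2} ⊆ K → False) →
      (∀ y ∈ {y : EuclideanSpace ℝ (Fin 3) | y 2 = 0 ∧ v (-1) y 2 = v (-1) 0 2}, ∀ r : ℝ, 0 < r →
        ∃ y' : EuclideanSpace ℝ (Fin 3), y' 2 = 0 ∧ dist y' y < r ∧ v (-1) y' 2 ≠ v (-1) 0 2) →
      (∀ y ∈ {y : EuclideanSpace ℝ (Fin 3) | y 2 = 0 ∧ v (-1) y 2 = v (-1) 0 2}, Literature.Analysis.FluidPDE.curl (v (-1)) y = 0) →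
      ∀ (σ κ : ℝ) (y₁ : EuclideanSpace ℝ (Fin 3)) (c₁ : Fin 3), (σ = 1 ∨ σ = -1) → σ * v (-1) 0 2 = |v (-1) 0 2| → 0 < κ →
        (∀ y : EuclideanSpace ℝ (Fin 3), y 2 = 0 → v (-1) y 2 = v (-1) 0 2 →
          fderiv ℝ (fderiv ℝ (fun x => σ * v (-1) x 2)) y (EuclideanSpace.single 0 1) (EuclideanSpace.single 0 1) +
            fderiv ℝ (fderiv ℝ (fun x => σ * v (-1) x 2)) y (EuclideanSpace.single 1 1) (EuclideanSpace.single 1 1) = -κ) →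
        y₁ 2 = 0 → c₁ ≠ 2 → fderiv ℝ (v (-1)) y₁ (EuclideanSpace.single c₁ 1) 2 ≠ 0 →
        (∃ (γ : ℝ → EuclideanSpace ℝ (Fin 3)) (φ : ℕ → ℕ) (U : ℝ → EuclideanSpace ℝ (Fin 3) → EuclideanSpace ℝ (Fin 3)) (Γ νΓ : ℝ → EuclideanSpace ℝ (Fin 3))
        (F : ℝ → EuclideanSpace ℝ (Fin 3) → ℝ) (R : ℝ → ℝ → ℝ) (r δ m : ℝ) (μ : ℝ → ℝ → ℝ) (ρ : ℝ),
        -- the complete hot branch of BRANCH-PARAM (LEAD g15 `exists_complete_hotBranch_of_ridge`)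
        ((ContDiff ℝ 2 γ ∧ γ 0 = 0 ∧ (∀ s, γ s 2 = 0) ∧ (∀ s, ‖deriv γ s‖ = 1) ∧ (∀ s, v (-1) (γ s) 2 = v (-1) 0 2) ∧
          (∀ s, fderiv ℝ (fderiv ℝ (fun y => σ * v (-1) y 2)) (γ s) (WithLp.toLp 2 ![-(deriv γ s 1), deriv γ s 0, 0])
            (WithLp.toLp 2 ![-(deriv γ s 1), deriv γ s 0, 0]) = -κ) ∧
          (∀ s w, fderiv ℝ (fderiv ℝ (fun y => σ * v (-1) y 2)) (γ s) (deriv γ s) w = 0)) ∧ StrictMono φ ∧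
        -- the hull limit (pinned, peakless, same hot value), slices converging locally uniformly, re-based branches converging to `Γ`
        (Literature.Analysis.FluidPDE.HasTypeITimeDecay C U ∧
          ContinuousOn (Function.uncurry U) (Set.Iio (0 : ℝ) ×ˢ Set.univ) ∧
          (∀ s t : ℝ, s < t → t < 0 → ∀ x, U t x =
            Literature.Analysis.UnboundedOperators.heatExtension (U s) (t - s) x -
              Literature.Analysis.FluidPDE.oseenDuhamel 1 s U U t x) ∧
          (∀ t < 0, Literature.Analysis.FluidPDE.VectorCalculus.IsDivFree (U t)) ∧
          (∀ s < 0, ∀ q, ⟪Literature.Analysis.FluidPDE.curl (U s) q, EuclideanSpace.single 2 1⟫_ℝ = 0) ∧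
          U (-1) 0 2 ≠ 0 ∧ (∀ t < 0, ∀ x, Real.sqrt (-t) * |U t x 2| ≤ |U (-1) 0 2|) ∧
          (∀ h : EuclideanSpace ℝ (Fin 3), fderiv ℝ (U (-1)) 0 h 2 = 0) ∧
          (deriv (fun s => U s 0 2) (-1) = U (-1) 0 2 / 2 ∧ U (-1) 0 2 * (Δ (fun q => U (-1) q 2)) 0 ≤ 0)) ∧
        (∀ (s z₀ σ M : ℝ) (K O : Set (EuclideanSpace ℝ (Fin 3))), s < 0 →
          ((σ = 1 ∨ σ = -1) ∧ IsCompact K ∧ K.Nonempty ∧ (∀ q ∈ K, q 2 = z₀ ∧ σ * U s q 2 = M) ∧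
            IsOpen O ∧ K ⊆ O ∧ (∀ q ∈ O, q 2 = z₀ → σ * U s q 2 ≤ M) ∧
            (∀ q ∈ O, q 2 = z₀ → σ * U s q 2 = M → q ∈ K)) → False) ∧
        U (-1) 0 2 = v (-1) 0 2 ∧
        (∀ t < 0, TendstoLocallyUniformly (fun j x => v t (x + γ ((φ j : ℕ) : ℝ))) (U t) atTop) ∧
        (∀ s, Tendsto (fun j => γ (((φ j : ℕ) : ℝ) + s) - γ ((φ j : ℕ) : ℝ)) atTop (𝓝 (Γ s))) ∧
        -- re-entry package of the limit branch
        (∀ y ∈ {y : EuclideanSpace ℝ (Fin 3) | y 2 = 0 ∧ U (-1) y 2 = U (-1) 0 2}, fderiv ℝ (fun x => U (-1) x 2) y = 0) ∧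
        ContDiff ℝ ∞ Γ ∧ Γ 0 = 0 ∧ (∀ s, Γ s 2 = 0) ∧ (∀ s, ‖deriv Γ s‖ = 1) ∧ (∀ s, U (-1) (Γ s) 2 = U (-1) 0 2) ∧
        (∀ s, νΓ s = WithLp.toLp 2 ![-(deriv Γ s 1), deriv Γ s 0, 0]) ∧
        (∀ s, κ ≤ -(fderiv ℝ (fderiv ℝ (fun y => σ * U (-1) y 2)) (Γ s) (νΓ s) (νΓ s))) ∧
        -- the signed space–time component, the homogeneous ridge height, the tube radius, the window, the level
        (F = fun τ y => σ * U (-1 + τ) y 2) ∧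
        (∀ τ z, R τ z = sSup ((fun n : ℝ => F τ (Γ 0 + n • νΓ 0 + z • EuclideanSpace.single 2 (1 : ℝ))) '' Icc (-r) r)) ∧
        0 < r ∧ 0 < δ ∧ δ ≤ 1 / 4 ∧
        -- (Q3∞): the cross-section maximum is homogeneous along `Γ`
        (∀ τ z : ℝ, |τ| < δ → |z| < δ → ∀ s : ℝ,
          sSup ((fun n : ℝ => F τ (Γ s + n • νΓ s + z • EuclideanSpace.single 2 (1 : ℝ))) '' Icc (-r) r) = R τ z) ∧
        -- cold lateral values, hot centre
        (∀ τ z : ℝ, |τ| < δ → |z| < δ → ∀ s n : ℝ, (n = r ∨ n = -r) → F τ (Γ s + n • νΓ s + z • EuclideanSpace.single 2 (1 : ℝ)) < m) ∧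
        (∀ τ z : ℝ, |τ| < δ → |z| < δ → ∀ s : ℝ, m ≤ F τ (Γ s + z • EuclideanSpace.single 2 (1 : ℝ))) ∧
        -- strict concavity of the cross-sections on the open tube
        (∀ τ z : ℝ, |τ| < δ → |z| < δ → ∀ s : ℝ, ∀ n ∈ Ioo (-r) r,
          fderiv ℝ (fderiv ℝ (F τ)) (Γ s + n • νΓ s + z • EuclideanSpace.single 2 (1 : ℝ)) (νΓ s) (νΓ s) < 0) ∧
        -- THE WEB FERMAT LAW at every cross-section
        (∀ τ₀ z₀ : ℝ, |τ₀| < δ → |z₀| < δ → ∀ s₀ : ℝ, ∃ n₀ ∈ Ioo (-r) r,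
          F τ₀ (Γ s₀ + n₀ • νΓ s₀ + z₀ • EuclideanSpace.single 2 (1 : ℝ)) = R τ₀ z₀ ∧
          (∀ n ∈ Icc (-r) r, n ≠ n₀ → F τ₀ (Γ s₀ + n • νΓ s₀ + z₀ • EuclideanSpace.single 2 (1 : ℝ)) < R τ₀ z₀) ∧
          DifferentiableAt ℝ (uncurry R) (τ₀, z₀) ∧
          fderiv ℝ (uncurry F) (τ₀, Γ s₀ + n₀ • νΓ s₀ + z₀ • EuclideanSpace.single 2 (1 : ℝ)) =
            (fderiv ℝ (uncurry R) (τ₀, z₀)).comp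
              ((ContinuousLinearMap.fst ℝ ℝ (EuclideanSpace ℝ (Fin 3))).prod
                ((EuclideanSpace.proj (2 : Fin 3)).comp (ContinuousLinearMap.snd ℝ ℝ (EuclideanSpace ℝ (Fin 3)))))) ∧
        -- (TH) STRUCTURE OF THE HULL ELEMENT: the global bilinear identity, the frozen law, and the slope function of `v` on a uniform slab — the SAME `μ` for `U`
        (∀ t < 0, ∀ x x' : EuclideanSpace ℝ (Fin 3), x 2 = x' 2 → ∀ b c : Fin 3, b ≠ 2 → c ≠ 2 →
          fderiv ℝ (U t) x (EuclideanSpace.single 2 1) b * fderiv ℝ (U t) x' (EuclideanSpace.single c 1) 2 =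
            fderiv ℝ (U t) x' (EuclideanSpace.single 2 1) c * fderiv ℝ (U t) x (EuclideanSpace.single b 1) 2) ∧
        (∀ s < 0, ∀ y, ⟪fderiv ℝ (U s) y (Literature.Analysis.FluidPDE.curl (U s) y), EuclideanSpace.single 2 1⟫_ℝ = 0) ∧
        0 < ρ ∧ ρ ≤ 1 ∧ ContDiff ℝ 3 (uncurry μ) ∧
        μ (-1) 0 = fderiv ℝ (v (-1)) y₁ (EuclideanSpace.single 2 1) c₁ / fderiv ℝ (v (-1)) y₁ (EuclideanSpace.single c₁ 1) 2 ∧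
        (∀ t : ℝ, |t + 1| < ρ → ∀ x : EuclideanSpace ℝ (Fin 3), |x 2| < ρ → ∀ b : Fin 3, b ≠ 2 →
          fderiv ℝ (v t) x (EuclideanSpace.single 2 1) b = μ t (x 2) * fderiv ℝ (v t) x (EuclideanSpace.single b 1) 2) ∧
        (∀ t : ℝ, |t + 1| < ρ → ∀ x : EuclideanSpace ℝ (Fin 3), |x 2| < ρ → ∀ b : Fin 3, b ≠ 2 →
          fderiv ℝ (U t) x (EuclideanSpace.single 2 1) b = μ t (x 2) * fderiv ℝ (U t) x (EuclideanSpace.single b 1) 2) ∧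
        (∀ t₀ : ℝ, |t₀ + 1| < ρ → ∀ y₀ : EuclideanSpace ℝ (Fin 3), y₀ 2 = 0 →
          ∀ᶠ z in 𝓝 ((t₀, y₀) : ℝ × EuclideanSpace ℝ (Fin 3)), ∀ b : Fin 3, b ≠ 2 →
            fderiv ℝ (U z.1) z.2 (EuclideanSpace.single 2 1) b = μ z.1 (z.2 2) * fderiv ℝ (U z.1) z.2 (EuclideanSpace.single b 1) 2)) ∧
        -- (v9) the sub-cell
        (∃ a b : ℝ, ∀ z : ℝ, |z| < δ → R 0 z = a + b * z) ∧
        -- (v11) the sub-sub-cell: straight branch, non-vanishing (hence negative) slope at the hot spot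
        (∀ s : ℝ, Γ s = s • deriv Γ 0) ∧ ¬ (μ (-1) 0 = 0) ∧
        -- (v14) CASE I of T2B-g17 §1/§5: every nearby time is sonic
        (∃ δ' : ℝ, 0 < δ' ∧ ∀ τ : ℝ, |τ| < δ' → ∃ a b : ℝ, ∀ z : ℝ, |z| < δ → R τ z = a + b * z)) →
        False := by
  intro C v W hv hW hbil hpeak hfrozen hHcl hHgrad hHcomp hHiso hHcurl σ κ y₁ c₁ hσ hσN hκ hHlap hy₁ hc₁ hslope₁ hobj
  obtain ⟨γ, φ, U, Γ, νΓ, F, R, r, δ, m, μ, ρ, ⟨-, -, hUclass, hUpeak, hUN, -, -, hUcrit, hΓ, hΓ0, hΓ2, hΓunit, hΓhot, hν, hΓcurv, hFdef, -,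
    hr, hδ, -, -, -, -, hconc, hweb, -, -, hρ, -, hμ3, -, -, hslabU, hevU⟩, -, hline, hμ0, hI⟩ := hobj
  obtain ⟨hUrate, hUcont, hUmild, hUdiv, hUpol, hUne, hUhotbd, -, -⟩ := hUclass
  have hσN' : σ * U (-1) 0 2 = |U (-1) 0 2| := by rw [hUN, hσN]
  subst hFdef
  -- the entrance box
  obtain ⟨δs, n₀, κt, hδs, hδsρ, hδsh, he2, hunit, hpack, hsonB, hparN, hμnegB⟩ :=
    caseI_entrance hUrate hUcont hUmild hUdiv hUpol hUne hUhotbd hσ hσN' hκ hΓ0 hΓ2 hΓunit hΓhot hν hΓcurv hr hδ hconc hweb hρ hμ3 hslabU hevU hline hμ0 hI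
  -- the time window of the sheet data
  obtain ⟨τ₁, τ₂, hτ₁, hτ₁₂, hτ₂, hbr⟩ :=
    sheet_strain_window hUrate hUcont hUmild hUdiv hUpol hσ hμ3 hslabU hδsρ hδsh he2 hunit hpack hδs hsonB hparN hμnegB
  rcases hbr with hfree | ⟨L, hL, hper⟩
  · exact hSfreeEnd C σ ρ δs r U R μ (deriv Γ 0) n₀ κt τ₁ τ₂ hUrate hUcont hUmild hUdiv hUpol hUne hσ hμ3 hslabU hδsρ hδsh he2 hunit hpack hsonB hparN
      hμnegB hτ₁ hτ₁₂ hτ₂ hfree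
  · exact hPeriodicEnd C σ ρ δs r U R μ (deriv Γ 0) n₀ κt τ₁ τ₂ L hUrate hUcont hUmild hUdiv hUpol hUne hσ hμ3 hslabU hδsρ hδsh he2 hunit hpack hsonB hparN
      hμnegB hτ₁ hτ₁₂ hτ₂ hL hper

end Summit.NavierStokesRegularity.NavierStokesRegularity.Theorems.PoloidalWindowDoorLrcModEntireCaseISonicTimes

end
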